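import Mathlib.Analysis.InnerProductSpace.Harmonic.Basic
import Mathlib.Analysis.Calculus.ParametricIntegral
import Mathlib.MeasureTheory.Measure.Haar.NormedSpace
import Mathlib.MeasureTheory.Integral.IntervalIntegral.FundThmCalculus
import Literature.Analysis.FluidPDE.WholeSpaceIBP
import HarnessLib

/-!
# The mean value property of harmonic functions, weighted radial form

Analysis/FluidPDE support file for the discharge of the named fact
`Literature.Analysis.FluidPDE.harmonic_integral_mul_radial` (`FluidPDE/NormalisedPressureProofs`, input F4 of
Tao's pressure-normalisation lemma, Tao 2011 Lemma 4.1 (i)).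

Let `E` be a finite-dimensional real inner product space with its Lebesgue measure. We prove
(`integral_radial_mul_harmonic`): if `η : E → ℝ` is harmonic on all of `E` (Mathlib
`InnerProductSpace.HarmonicOnNhd η univ`) and `w : E → ℝ` is a continuous compactly supported
**radial** weight (`w x` depends only on `‖x‖`), then for every centre `x₀`

  `∫ w(x) η(x₀ + x) dx = (∫ w) · η(x₀)`.

This is Gilbarg–Trudinger, Thm 2.1 (`u(y) = (n ωₙ Rⁿ⁻¹)⁻¹ ∫_{∂B_R(y)} u ds`) integrated against
the radial profile of `w`. Mathlib (this pin) has no mean value property on `ℝⁿ` (only the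
complex `circleAverage` theory) and no divergence theorem on balls, so the classical proof via
`d/dr ⨍_{∂B_r} u = ⨍ ∂_ν u = 0` is not available. We give a boundary-free proof.

## Proof

Put `J(s) := ∫ w(y) η(x₀ + s y) dy` for `s ∈ ℝ`, so that `J(1)` is the left-hand side and
`J(0) = (∫ w) η(x₀)`. Differentiating under the integral sign (`w` has compact support, `η` is
`C¹`), `J'(s) = ∫ w(y) ⟨y, ∇η(x₀ + s y)⟩ dy`.
* For `s ≠ 0`, rescaling `y = s⁻¹ x` reduces `J'(s) = 0` to the **core identity**
  `∫ w̃(x) ⟨x, ∇η̃(x)⟩ dx = 0` for the radial weight `w̃ = w(s⁻¹ ·)` and the harmonic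
  translate `η̃ = η(x₀ + ·)`. For this, write the radial field `w̃(x) x` as a gradient:
  `w̃(x) x = ∇P(x)` with `P(x) = ½ ∫₀^{‖x‖²} φ - const`, `φ(τ) = w̃(√τ e)` the radial profile
  (`e` a unit vector), and `P` has compact support because the constant is `½ ∫₀^{ρ²} φ` with
  `supp w̃ ⊂ B_ρ`. Then Green's first identity without boundary terms
  (`Fluid.integral_inner_laplacian_add_eq_zero`: `∫ Δη̃ P + Σᵢ ∫ ∂ᵢη̃ ∂ᵢP = 0`) and `Δη̃ = 0`
  give `∫ ⟨∇P, ∇η̃⟩ = 0`.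
* For `s = 0` the integrand `w(y) ⟨y, ∇η(x₀)⟩` is odd, so `J'(0) = 0`.
Hence `J` is constant (`is_const_of_deriv_eq_zero`) and `J(1) = J(0)`.

## Main statements

* `Literature.Analysis.FluidPDE.exists_radial_primitive`: a continuous compactly supported radial `w` admits a
  `C¹` compactly supported `P` with `DP(y) = w(y) ⟨y, ·⟩`.
* `Literature.Analysis.FluidPDE.integral_radial_mul_fderiv_apply_self_eq_zero`: the core identity.
* `Literature.Analysis.FluidPDE.integral_radial_mul_harmonic`: the weighted mean value property (any centre).

## References

* D. Gilbarg, N. S. Trudinger, *Elliptic partial differential equations of second order*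
  (Springer, 2001 reprint), Thm 2.1 and (2.7)–(2.8).
* T. Tao, *Localisation and compactness properties of the Navier–Stokes global regularity
  problem*, Anal. PDE 6 (2013) = arXiv:1108.1165, §4, proof of Lemma 4.1 (i) ("by the
  mean-value property of harmonic functions (and our choice of `χ`)").
-/

noncomputable section

open MeasureTheory Set Filter Metric Topology InnerProductSpace Function
open scoped RealInnerProductSpace Laplacian

namespace Literature.Analysis.FluidPDE

variable {E : Type*} [NormedAddCommGroup E] [InnerProductSpace ℝ E] [FiniteDimensional ℝ E]

/-! ### Harmonic functions on the whole space: unpacking Mathlib's `HarmonicOnNhd` -/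

/-- A function harmonic on all of `E` is `C²`. [folklore] -/
theorem contDiff_two_of_harmonicOnNhd_univ {η : E → ℝ} (h : HarmonicOnNhd η univ) :
    ContDiff ℝ 2 η :=
  contDiff_iff_contDiffAt.2 fun x => (h x (mem_univ x)).1

/-- A function harmonic on all of `E` has vanishing Laplacian everywhere. [folklore] -/
theorem laplacian_eq_zero_of_harmonicOnNhd_univ {η : E → ℝ} (h : HarmonicOnNhd η univ) (x : E) :
    (Δ η) x = 0 :=
  (h x (mem_univ x)).2.eq_of_nhds

/-- The Laplacian commutes with translations: `Δ(f(a + ·))(x) = (Δ f)(a + x)`. [folklore] -/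
theorem laplacian_comp_const_add {F : Type*} [NormedAddCommGroup F] [NormedSpace ℝ F]
    (f : E → F) (a x : E) : (Δ (fun z => f (a + z))) x = (Δ f) (a + x) := by
  rw [laplacian_eq_iteratedFDeriv_stdOrthonormalBasis,
    laplacian_eq_iteratedFDeriv_stdOrthonormalBasis]
  simp only [iteratedFDeriv_comp_add_left]

/-! ### The radial primitive `∇P = w(y) y` -/

/-- **Radial fields are gradients.** A continuous, compactly supported, radial `w : E → ℝ`
admits a compactly supported `C¹` function `P` with `DP(y) = w(y) ⟨y, ·⟩`, namely
`P(y) = ½ ∫₀^{‖y‖²} φ − ½ ∫₀^{ρ²} φ` with `φ(τ) = w(√τ e)` the radial profile and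
`supp w ⊂ B_ρ`. [folklore] -/
theorem exists_radial_primitive {w : E → ℝ} (hw : Continuous w) (hc : HasCompactSupport w)
    (hrad : ∀ x y, ‖x‖ = ‖y‖ → w x = w y) :
    ∃ P : E → ℝ, ContDiff ℝ 1 P ∧ HasCompactSupport P ∧
      ∀ y, HasFDerivAt P (w y • (innerSL ℝ y : E →L[ℝ] ℝ)) y := by
  rcases subsingleton_or_nontrivial E with hE | hE
  · refine ⟨0, contDiff_const, HasCompactSupport.zero, fun y => ?_⟩
    have hy : y = 0 := Subsingleton.elim y 0
    rw [hy, map_zero, smul_zero]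
    exact hasFDerivAt_const (0 : ℝ) 0
  -- a unit vector and the radial profile
  obtain ⟨e, he⟩ : ∃ e : E, ‖e‖ = 1 := exists_norm_eq E zero_le_one
  set φ : ℝ → ℝ := fun τ => w (Real.sqrt τ • e) with hφ_def
  have hφ : Continuous φ := hw.comp (Real.continuous_sqrt.smul continuous_const)
  have hφw : ∀ y : E, φ (‖y‖ ^ 2) = w y := fun y => by
    refine hrad _ _ ?_
    rw [norm_smul, he, mul_one, Real.norm_eq_abs, Real.sqrt_sq (norm_nonneg _),
      abs_of_nonneg (norm_nonneg _)]
  -- the support radius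
  obtain ⟨ρ, hρ, hρw⟩ : ∃ ρ : ℝ, 0 < ρ ∧ tsupport w ⊆ ball (0 : E) ρ :=
    hc.isCompact.isBounded.subset_ball_lt 0 0
  have hφ0 : ∀ τ, ρ ^ 2 ≤ τ → φ τ = 0 := fun τ hτ => by
    refine image_eq_zero_of_notMem_tsupport (f := w) fun hmem => ?_
    have h1 := hρw hmem
    rw [mem_ball_zero_iff, norm_smul, he, mul_one, Real.norm_eq_abs,
      abs_of_nonneg (Real.sqrt_nonneg _)] at h1
    have h2 : ρ ≤ Real.sqrt τ := by
      rw [← Real.sqrt_sq hρ.le]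
      exact Real.sqrt_le_sqrt hτ
    linarith
  -- the primitive of the profile
  set Q : ℝ → ℝ := fun σ => ∫ τ in (0 : ℝ)..σ, φ τ with hQ_def
  have hQ : ∀ σ, HasDerivAt Q (φ σ) σ := fun σ => (hφ.integral_hasStrictDerivAt 0 σ).hasDerivAt
  have hQρ : ∀ σ, ρ ^ 2 ≤ σ → Q σ = Q (ρ ^ 2) := fun σ hσ => by
    have hi : ∀ a b : ℝ, IntervalIntegrable φ volume a b := fun a b =>
      hφ.intervalIntegrable a b
    have h1 : Q σ - Q (ρ ^ 2) = ∫ τ in (ρ ^ 2)..σ, φ τ := by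
      simp only [hQ_def]
      rw [intervalIntegral.integral_interval_sub_left (hi _ _) (hi _ _)]
    have h2 : ∫ τ in (ρ ^ 2)..σ, φ τ = 0 := by
      rw [← intervalIntegral.integral_zero (a := ρ ^ 2) (b := σ) (μ := volume)]
      refine intervalIntegral.integral_congr fun τ hτ => ?_
      rw [uIcc_of_le hσ] at hτ
      exact hφ0 τ hτ.1
    linarith
  -- the primitive on `E`
  set P : E → ℝ := fun y => 2⁻¹ * (Q (‖y‖ ^ 2) - Q (ρ ^ 2)) with hP_def
  have hP : ∀ y, HasFDerivAt P (w y • (innerSL ℝ y : E →L[ℝ] ℝ)) y := fun y => by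
    have h1 : HasFDerivAt (fun y : E => ‖y‖ ^ 2) (2 • (innerSL ℝ y : E →L[ℝ] ℝ)) y :=
      (hasStrictFDerivAt_norm_sq y).hasFDerivAt
    have h2 : HasFDerivAt (fun y : E => Q (‖y‖ ^ 2))
        (φ (‖y‖ ^ 2) • (2 • (innerSL ℝ y : E →L[ℝ] ℝ))) y := by
      have := (hQ (‖y‖ ^ 2)).comp_hasFDerivAt y h1
      simpa only [Function.comp_def] using this
    have h3 := ((h2.sub_const (Q (ρ ^ 2))).const_mul 2⁻¹)
    refine h3.congr_fderiv ?_
    ext v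
    simp only [_root_.FunLike.coe_smul, Pi.smul_apply, smul_eq_mul, hφw y]
    ring
  have hP0 : ∀ y, y ∉ closedBall (0 : E) ρ → P y = 0 := fun y hy => by
    rw [mem_closedBall_zero_iff, not_le] at hy
    have : ρ ^ 2 ≤ ‖y‖ ^ 2 := by gcongr
    simp [hP_def, hQρ _ this]
  have hPc : HasCompactSupport P := HasCompactSupport.intro (isCompact_closedBall 0 ρ) hP0
  have hcont : Continuous fun y : E => w y • (innerSL ℝ y : E →L[ℝ] ℝ) :=
    hw.smul (innerSL ℝ (E := E)).continuous
  exact ⟨P, contDiff_one_iff_hasFDerivAt.2 ⟨_, hcont, hP⟩, hPc, hP⟩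

/-! ### The core identity -/

section Volume

variable [MeasurableSpace E] [BorelSpace E]

/-- **Core identity.** For `η ∈ C²(E)` with `Δη = 0` and a continuous compactly supported radial
weight `w`, `∫ w(y) Dη(y)[y] dy = 0`: writing `w(y) y = ∇P(y)` (`exists_radial_primitive`),
this is `∫ ⟨∇P, ∇η⟩ = -∫ P Δη = 0` by Green's first identity without boundary terms.
[cite: GilbargTrudinger2001, Thm 2.1] -/
theorem integral_radial_mul_fderiv_apply_self_eq_zero {η w : E → ℝ} (hη : ContDiff ℝ 2 η)
    (hΔ : ∀ x, (Δ η) x = 0) (hw : Continuous w) (hc : HasCompactSupport w)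
    (hrad : ∀ x y, ‖x‖ = ‖y‖ → w x = w y) :
    ∫ y, w y * fderiv ℝ η y y = 0 := by
  obtain ⟨P, hP1, hPc, hP⟩ := exists_radial_primitive hw hc hrad
  set b := stdOrthonormalBasis ℝ E
  have hη1 : ContDiff ℝ 1 η := hη.of_le one_le_two
  -- Green's first identity: `∫ Δη P + Σᵢ ∫ ∂ᵢη ∂ᵢP = 0`, and `Δη = 0`
  have green := FluidPDE.integral_inner_laplacian_add_eq_zero b hη hP1 (Or.inr hPc)
  have h0 : ∫ x, ⟪(Δ η) x, P x⟫ = 0 := by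
    simp [hΔ]
  rw [h0, zero_add] at green
  -- the integrand is the sum over the basis
  have hfd : ∀ y, fderiv ℝ P y = w y • (innerSL ℝ y : E →L[ℝ] ℝ) := fun y => (hP y).fderiv
  have key : ∀ y, w y * fderiv ℝ η y y =
      ∑ i, ⟪fderiv ℝ η y (b i), fderiv ℝ P y (b i)⟫ := fun y => by
    have hs : fderiv ℝ η y y = ∑ i, ⟪b i, y⟫ * fderiv ℝ η y (b i) := by
      have : fderiv ℝ η y y = fderiv ℝ η y (∑ i, ⟪b i, y⟫ • b i) := by rw [b.sum_repr' y]
      rw [this, map_sum]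
      simp only [map_smul, smul_eq_mul]
    rw [hs, Finset.mul_sum]
    refine Finset.sum_congr rfl fun i _ => ?_
    rw [hfd y]
    simp only [_root_.FunLike.coe_smul, Pi.smul_apply, innerSL_apply_apply, smul_eq_mul]
    simp only [RCLike.inner_apply, conj_trivial]
    rw [real_inner_comm]
    ring
  have hint : ∀ i, Integrable (fun y => ⟪fderiv ℝ η y (b i), fderiv ℝ P y (b i)⟫)
      (volume : Measure E) := fun i => by
    refine Continuous.integrable_of_hasCompactSupport ?_ ?_
    · exact (((hη1.continuous_fderiv one_ne_zero).clm_apply continuous_const)).inner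
        ((hP1.continuous_fderiv one_ne_zero).clm_apply continuous_const)
    · exact (hPc.fderiv_apply (𝕜 := ℝ) (b i)).mono fun y hy => by
        contrapose! hy
        simp only [mem_support, not_not] at hy
        simp [hy]
  simp_rw [key]
  rw [integral_finsetSum _ fun i _ => hint i]
  exact green

/-! ### The weighted mean value property -/

/-- **Mean value property, weighted radial form (Gilbarg–Trudinger, Thm 2.1).** If `η` is
harmonic on all of `E` and `w` is a continuous compactly supported radial weight, then
`∫ w(x) η(x₀ + x) dx = (∫ w) · η(x₀)` for every centre `x₀`. Proof: `J(s) = ∫ w(y) η(x₀ + s y) dy`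
has derivative `∫ w(y) Dη(x₀ + s y)[y] dy`, which vanishes for `s ≠ 0` by rescaling to the core
identity `integral_radial_mul_fderiv_apply_self_eq_zero` and for `s = 0` by oddness; hence
`J(1) = J(0)`. [cite: GilbargTrudinger2001, Thm 2.1] -/
theorem integral_radial_mul_harmonic {η w : E → ℝ} (hη : HarmonicOnNhd η univ)
    (hw : Continuous w) (hc : HasCompactSupport w) (hrad : ∀ x y, ‖x‖ = ‖y‖ → w x = w y)
    (x₀ : E) : ∫ x, w x * η (x₀ + x) = (∫ x, w x) * η x₀ := by
  have hη2 : ContDiff ℝ 2 η := contDiff_two_of_harmonicOnNhd_univ hη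
  have hη1 : ContDiff ℝ 1 η := hη2.of_le one_le_two
  have hΔ := laplacian_eq_zero_of_harmonicOnNhd_univ hη
  have hηc : Continuous η := hη2.continuous
  have hDηc : Continuous (fderiv ℝ η) := hη1.continuous_fderiv one_ne_zero
  have hηd : ∀ z, HasFDerivAt η (fderiv ℝ η z) z := fun z =>
    (hη1.differentiable one_ne_zero z).hasFDerivAt
  -- the one-parameter family and its derivative
  set J : ℝ → ℝ := fun s => ∫ y, w y * η (x₀ + s • y) with hJ_def
  set J' : ℝ → ℝ := fun s => ∫ y, w y * fderiv ℝ η (x₀ + s • y) y with hJ'_def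
  -- support radius of `w`
  obtain ⟨ρ, hρ, hρw⟩ : ∃ ρ : ℝ, 0 < ρ ∧ tsupport w ⊆ ball (0 : E) ρ :=
    hc.isCompact.isBounded.subset_ball_lt 0 0
  have hw0 : ∀ y : E, ρ ≤ ‖y‖ → w y = 0 := fun y hy =>
    image_eq_zero_of_notMem_tsupport fun h => by
      have := hρw h
      rw [mem_ball_zero_iff] at this
      linarith
  -- Step 1: differentiation under the integral sign
  have hderiv : ∀ s, HasDerivAt J (J' s) s := by
    intro s
    -- a bound for `∇η` on the relevant compact set
    obtain ⟨C, hC⟩ := (isCompact_closedBall x₀ ((|s| + 1) * ρ)).exists_bound_of_continuousOn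
      hDηc.continuousOn
    have hC0 : 0 ≤ C := le_trans (norm_nonneg _) (hC x₀ (mem_closedBall_self (by positivity)))
    have haff : ∀ s' : ℝ, Continuous fun y : E => x₀ + s' • y := fun s' =>
      continuous_const.add (continuous_id.const_smul s')
    have hFc : ∀ s', Continuous fun y => w y * η (x₀ + s' • y) := fun s' =>
      hw.mul (hηc.comp (haff s'))
    have hF_meas : ∀ s', AEStronglyMeasurable (fun y => w y * η (x₀ + s' • y))
        (volume : Measure E) := fun s' => (hFc s').aestronglyMeasurable
    have hF_int : Integrable (fun y => w y * η (x₀ + s • y)) (volume : Measure E) :=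
      (hFc s).integrable_of_hasCompactSupport hc.mul_right
    have hF'c : Continuous fun y => w y * fderiv ℝ η (x₀ + s • y) y :=
      hw.mul ((hDηc.comp (haff s)).clm_apply continuous_id)
    have hF'_meas : AEStronglyMeasurable (fun y => w y * fderiv ℝ η (x₀ + s • y) y)
        (volume : Measure E) := hF'c.aestronglyMeasurable
    have h_bound : ∀ᵐ y ∂(volume : Measure E), ∀ s' ∈ ball s 1,
        ‖w y * fderiv ℝ η (x₀ + s' • y) y‖ ≤ C * ρ * |w y| := by
      refine Eventually.of_forall fun y s' hs' => ?_
      rcases le_or_gt ρ ‖y‖ with hy | hy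
      · simp [hw0 y hy]
      · have hmem : x₀ + s' • y ∈ closedBall x₀ ((|s| + 1) * ρ) := by
          rw [mem_closedBall, dist_eq_norm, add_sub_cancel_left, norm_smul, Real.norm_eq_abs]
          have hs'1 : |s'| ≤ |s| + 1 := by
            rw [mem_ball, Real.dist_eq] at hs'
            have := abs_sub_abs_le_abs_sub s' s
            linarith
          exact mul_le_mul hs'1 hy.le (norm_nonneg _) (by positivity)
        rw [norm_mul, Real.norm_eq_abs]
        calc |w y| * ‖fderiv ℝ η (x₀ + s' • y) y‖
            ≤ |w y| * (C * ρ) := by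
              refine mul_le_mul_of_nonneg_left ?_ (abs_nonneg _)
              calc ‖fderiv ℝ η (x₀ + s' • y) y‖ ≤ ‖fderiv ℝ η (x₀ + s' • y)‖ * ‖y‖ :=
                    ContinuousLinearMap.le_opNorm _ _
                _ ≤ C * ρ := mul_le_mul (hC _ hmem) hy.le (norm_nonneg _) hC0
          _ = C * ρ * |w y| := by ring
    have h_diff : ∀ᵐ y ∂(volume : Measure E), ∀ s' ∈ ball s 1,
        HasDerivAt (fun r => w y * η (x₀ + r • y)) (w y * fderiv ℝ η (x₀ + s' • y) y) s' := by
      refine Eventually.of_forall fun y s' _ => ?_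
      have h1 : HasDerivAt (fun r : ℝ => x₀ + r • y) y s' := by
        simpa using ((hasDerivAt_id s').smul_const y).const_add x₀
      have h2 := (hηd (x₀ + s' • y)).comp_hasDerivAt s' h1
      exact h2.const_mul (w y)
    exact (hasDerivAt_integral_of_dominated_loc_of_deriv_le (ball_mem_nhds s one_pos)
      (Eventually.of_forall hF_meas) hF_int hF'_meas h_bound
      ((hw.abs.integrable_of_hasCompactSupport hc.abs).const_mul (C * ρ)) h_diff).2
  -- Step 2: the derivative vanishes
  have hJ'0 : ∀ s, J' s = 0 := by
    intro s
    rcases eq_or_ne s 0 with rfl | hs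
    · -- oddness at `s = 0`
      have hodd : ∀ y : E, w ((-1 : ℝ) • y) * fderiv ℝ η (x₀ + (0 : ℝ) • ((-1 : ℝ) • y))
          ((-1 : ℝ) • y) = -(w y * fderiv ℝ η (x₀ + (0 : ℝ) • y) y) := fun y => by
        rw [hrad ((-1 : ℝ) • y) y (by simp)]
        simp
      have h1 := Measure.integral_comp_smul (volume : Measure E)
        (fun y => w y * fderiv ℝ η (x₀ + (0 : ℝ) • y) y) (-1)
      simp only [hodd, integral_neg, abs_inv, abs_pow, abs_neg, abs_one,
        one_pow, inv_one, one_smul] at h1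
      show (∫ y, w y * fderiv ℝ η (x₀ + (0 : ℝ) • y) y) = 0
      linarith
    · -- rescaling to the core identity for `s ≠ 0`
      set wt : E → ℝ := fun x => w (s⁻¹ • x) with hwt
      set ηt : E → ℝ := fun x => η (x₀ + x) with hηt
      have hwt_c : Continuous wt := hw.comp (continuous_const.smul continuous_id)
      have hwt_s : HasCompactSupport wt := hc.comp_smul (inv_ne_zero hs)
      have hwt_r : ∀ x y, ‖x‖ = ‖y‖ → wt x = wt y := fun x y hxy =>
        hrad _ _ (by simp [norm_smul, hxy])
      have hηt2 : ContDiff ℝ 2 ηt := hη2.comp (contDiff_const.add contDiff_id)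
      have hηtΔ : ∀ x, (Δ ηt) x = 0 := fun x => by
        rw [hηt, laplacian_comp_const_add, hΔ]
      have core := integral_radial_mul_fderiv_apply_self_eq_zero hηt2 hηtΔ hwt_c hwt_s hwt_r
      have hfd : ∀ x, fderiv ℝ ηt x = fderiv ℝ η (x₀ + x) := fun x => fderiv_comp_add_left x₀
      simp_rw [hfd] at core
      -- substitute `y = s⁻¹ x`
      set f : E → ℝ := fun x => wt x * fderiv ℝ η (x₀ + x) (s⁻¹ • x) with hf
      have h1 : (fun y => w y * fderiv ℝ η (x₀ + s • y) y) = fun y => f (s • y) := by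
        funext y
        simp only [hf, hwt, inv_smul_smul₀ hs]
      have h2 : ∫ x, f x = s⁻¹ * ∫ x, wt x * fderiv ℝ η (x₀ + x) x := by
        rw [← integral_const_mul]
        refine integral_congr_ae (Eventually.of_forall fun x => ?_)
        simp only [hf, map_smul, smul_eq_mul]
        ring
      show (∫ y, w y * fderiv ℝ η (x₀ + s • y) y) = 0
      rw [h1, Measure.integral_comp_smul volume f s, h2, core, mul_zero, smul_zero]
  -- Step 3: `J` is constant, `J 1 = J 0`
  have hconst : J 1 = J 0 :=
    is_const_of_deriv_eq_zero (fun s => (hderiv s).differentiableAt)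
      (fun s => by rw [(hderiv s).deriv, hJ'0 s]) 1 0
  have hJ1 : J 1 = ∫ x, w x * η (x₀ + x) := by simp [hJ_def]
  have hJ0 : J 0 = (∫ x, w x) * η x₀ := by
    simp only [hJ_def, zero_smul, add_zero]
    exact integral_mul_const (η x₀) w
  rw [← hJ1, hconst, hJ0]

end Volume

end Literature.Analysis.FluidPDE

end
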